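import Summits.QuantumFields.YangMills.Theorems.BalabanLadderUVSeamRecCeilingsGuardedPeelingEvents
import Summits.QuantumFields.YangMills.Theorems.BalabanLadderUVSeamRecCeilingsDLRPeelingLinearBudget
import HarnessLib

/-!
# Crux `UVSeamRec` (stmt-QuantumFields-20043), lane B: the level slices of the TELESCOPED influence functional — sign × residue classes,
# Hölder over the chain steps, linearisation

Helper file (`--supports stmt-QuantumFields-20043`) of the width-lever seat `ym-20043-ceilings-p2` (lane B, gen 9); sequel of
`…CeilingsGuardedPeelingEvents` (guarded events, telescoping, window-family law from (GUCR)) and gen 8's `…CeilingsDLRPeelingLinearBudget`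
(slices, geometric Hölder across levels, linearised budget).  After telescoping, the level-`k` slice of the doubled influence functional of a
separated cube family is `Σ_{γ ∈ slice_k} a_γ · Σ_{j<J} 1_{G_j(γ)}`, `G_j(γ) = largeFieldEvent (ρ^j ε_k) (parent^j γ) ∖ largeFieldEvent (ρ^{j+1} ε_k)
(parent^{j+1} γ)`, `a_γ = Σ_{i∈T} familyCoeff i γ` (gen 8's coefficients VERBATIM — the telescoping moves events, not coefficients).
* `abs_anchor_le_of_mem_familyShell` — anchors of the family shell of a reduced family lie in `[−(L+2R+2), L+2R+2]`.
* `torusE_exp_sum_guarded_le_of_reduced` — the window-family law for the `j`-th guarded events of a level-`k` slice of a REDUCED family: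
  `⟨exp(Σ t_γ 1_{G_j(γ)}∘lift)⟩ ≤ exp((1/K_j)Σ(e^{K_j t_γ} − 1)w)`, `K_j = 16·b^{4(j+1)s}·256(2m+4)⁴` (Hölder over the 16 sign classes × the
  `b^{4(j+1)s}` residues of the block index mod `b^{(j+1)s}`, each class by the prequel's `torusE_exp_sum_guarded_le_of_kernelBound`).
* `guarded_slice_exp_moment_trivial` / `guarded_slice_exp_moment_deep` — the slice moments: trivially `exp(c·J·1536·#T)`; in the deep zone (all
  parents fit, weights linearisable) `exp(c·(e−1)·1536·(Σ_{j<J} w_{k+js})·#T)` — LINEAR in the (GUCR) weights (Hölder over `j` with exponents `J`).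
HONEST FRAMING.  Folklore probability and arithmetic; (GUCR) is the OPEN one-box large-field input; nothing of E0′; not a gap, not Clay.
References: folklore.
-/

set_option autoImplicit false

noncomputable section

open MeasureTheory Filter Topology Finset
open Literature.Probability.LatticeModels
open Literature.MathematicalPhysics.QuantumFieldTheory (GaugeConfig wilsonMeasure LatticeRep isProbabilityMeasure_wilsonMeasure
  measurable_torusLift)
open Literature.MathematicalPhysics.QuantumLattice (LGConfig torusLift IsCylinder ymSpecification isProbabilityMeasure_ymSpecification
  integrable_of_abs_le fundamentalLatticeRep)

namespace Summit.QuantumFields.YangMills.Cruxes.UVSeamRec.DLRPeeling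

open Summit.QuantumFields.YangMills.Cruxes.OSLegsFromFemtoAndGap.DlrCollarTransfer
open Summit.QuantumFields.YangMills.Cruxes.UVSeamRec.PolymerData
open Summit.QuantumFields.YangMills.Cruxes.UVSeamRec.TemperedResponse
open Summit.QuantumFields.YangMills.Cruxes.UVSeamRec.BlockFieldLocality

/-! ## §1 The law for the guarded events of a level slice of a reduced family -/

section Law

/-- **Anchors of the family shell of a reduced family are bounded**: if `|x i c| ≤ L` for all cubes and `γ ∈ familyShell 𝔟 kmax R x` then
`|anchor 𝔟 γ c| ≤ L + 2R + 2` (the shell condition `dist_∞(x i, anchor) ≤ 2R+2`). [folklore] -/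
theorem abs_anchor_le_of_mem_familyShell (𝔟 : BlockSize) (kmax R L : ℕ) {n : ℕ} (x : Fin n → (Fin 4 → ℤ))
    (hred : ∀ i c, |x i c| ≤ (L : ℤ)) {γ : Polymer} (hγ : γ ∈ familyShell 𝔟 kmax R x) (c : Fin 4) :
    |(𝔟.b : ℤ) ^ γ.k * γ.y c| ≤ (L : ℤ) + 2 * R + 2 := by
  obtain ⟨i, _, hi⟩ := Finset.mem_biUnion.1 hγ
  have hshell := (mem_shell_iff 𝔟 kmax R (x i) γ).1 hi
  have hd : ((x i c - anchor 𝔟 γ c).natAbs : ℤ) ≤ ((2 * R + 2 : ℕ) : ℤ) := by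
    exact_mod_cast (PolymerData.natAbs_sub_le_supDist (x i) (anchor 𝔟 γ) c).trans hshell.2.2
  rw [Int.natCast_natAbs] at hd
  push_cast at hd
  have hx := abs_le.1 (hred i c)
  have ha := abs_le.1 hd
  simp only [anchor] at ha
  rw [abs_le]
  constructor <;> linarith [hx.1, hx.2, ha.1, ha.2]

variable {N : ℕ} [NeZero N] (r : LatticeRep (Matrix.specialUnitaryGroup (Fin N) ℂ))

/-- **THE LAW FOR THE `j`-TH GUARDED EVENTS OF A LEVEL SLICE OF A REDUCED FAMILY.**  `SU(N)`, any lattice representation, any `β`; odd torus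
`2L+1`, a REDUCED cube family (`|x i c| ≤ L`); ANY odd block size, collar `m ≥ 3`, guard depth `s`, ratio `ρ`, level `k`, chain step `j`, parent level
`k' = k + (j+1)s` with `(2m+1)b^{k'} + 3 ≤ 2L+1` and `L + 2R + 2 + 2b^{k'} ≤ 2L+1`; threshold `e`, weight `w ≥ 0` with the guarded one-box bound
(GUCR) at the child level `k + js` for `e` (as in `torusE_exp_sum_guarded_le_of_kernelBound`).  For every family `S` of level-`k` members of the
family shell and coefficients `t ≥ 0`:
`⟨exp(Σ_{γ∈S} t_γ 1_{G_j(γ)}∘lift)⟩ ≤ exp((1/K_j)·Σ_{γ∈S}(e^{K_j t_γ} − 1)·w)`,  `K_j = 16·(b^{(j+1)s})⁴·256(2m+4)⁴`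
— Hölder (`integral_exp_sum_le_of_partition`) over the classes (sign pattern of the anchor, block index mod `b^{(j+1)s}`), each class by
`torusE_exp_sum_guarded_le_of_kernelBound`. [folklore] -/
theorem torusE_exp_sum_guarded_le_of_reduced (β : ℝ) (𝔟 : BlockSize) (m : ℕ) (hm : 3 ≤ m) (s : ℕ) (ρ : ℝ) (k j kmax R L : ℕ)
    {n : ℕ} (x : Fin n → (Fin 4 → ℤ)) (hred : ∀ i c, |x i c| ≤ (L : ℤ))
    (hfit : (2 * m + 1) * 𝔟.b ^ (k + (j + 1) * s) + 3 ≤ 2 * L + 1)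
    (hroom : (L : ℤ) + 2 * R + 2 + 2 * (𝔟.b : ℤ) ^ (k + (j + 1) * s) ≤ 2 * L + 1) (e w : ℝ) (hw0 : 0 ≤ w)
    (hGUCR : ∀ (z : Fin 4 → ℤ) (μ ν : Fin 4) (h : μ < ν) (η : LGConfig 4 (Matrix.specialUnitaryGroup (Fin N) ℂ)),
      kerE (Matrix.specialUnitaryGroup (Fin N) ℂ) r β (fun c => (𝔟.b : ℤ) ^ (k + (j + 1) * s) * (z c / (𝔟.b : ℤ) ^ s - m))
        ((2 * m + 1) * 𝔟.b ^ (k + (j + 1) * s)) η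
        ((largeFieldEvent (N := N) 𝔟 e ⟨k + j * s, z, μ, ν, h⟩ \
          largeFieldEvent (N := N) 𝔟 (ρ * e) ⟨k + (j + 1) * s, fun c => z c / (𝔟.b : ℤ) ^ s, μ, ν, h⟩).indicator fun _ => (1 : ℝ)) ≤ w)
    (S : Finset Polymer) (hS : S ⊆ familyShell 𝔟 kmax R x) (hSk : ∀ γ ∈ S, γ.k = k)
    (t : Polymer → ℝ) (ht : ∀ γ ∈ S, 0 ≤ t γ) :
    torusE (Matrix.specialUnitaryGroup (Fin N) ℂ) r β L (fun U => Real.exp (∑ γ ∈ S,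
        t γ * (largeFieldEvent (N := N) 𝔟 e ⟨k + j * s, fun c => γ.y c / (𝔟.b : ℤ) ^ (j * s), γ.μ, γ.ν, γ.hμν⟩ \
          largeFieldEvent (N := N) 𝔟 (ρ * e)
            ⟨k + (j + 1) * s, fun c => γ.y c / (𝔟.b : ℤ) ^ ((j + 1) * s), γ.μ, γ.ν, γ.hμν⟩).indicator (fun _ => (1 : ℝ)) U)) ≤
      Real.exp (1 / (16 * ((𝔟.b : ℝ) ^ ((j + 1) * s)) ^ 4 * (256 * (2 * (m : ℝ) + 4) ^ 4)) *
        ∑ γ ∈ S, (Real.exp (16 * ((𝔟.b : ℝ) ^ ((j + 1) * s)) ^ 4 * (256 * (2 * (m : ℝ) + 4) ^ 4) * t γ) - 1) * w) := by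
  classical
  haveI := isProbabilityMeasure_wilsonMeasure (d := 4) (L := 2 * L + 1) r.ρ r.continuous β
  set nn : ℕ := 𝔟.b ^ ((j + 1) * s) with hnn
  have hnnpos : 0 < nn := by rw [hnn]; exact pow_pos 𝔟.pos _
  haveI : NeZero nn := ⟨hnnpos.ne'⟩
  have hnnZ : (0 : ℤ) < (nn : ℤ) := by exact_mod_cast hnnpos
  have hnnZ' : ((nn : ℕ) : ℤ) = (𝔟.b : ℤ) ^ ((j + 1) * s) := by rw [hnn]; push_cast; rfl
  -- the class map: sign pattern of the anchor, residue of the block index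
  let cls : Polymer → (Fin 4 → Bool) × (Fin 4 → Fin nn) := fun γ =>
    (fun c => decide (0 ≤ (𝔟.b : ℤ) ^ k * γ.y c),
     fun c => ⟨(γ.y c % (nn : ℤ)).toNat, (Int.toNat_lt (Int.emod_nonneg _ hnnZ.ne')).2 (Int.emod_lt_of_pos _ hnnZ)⟩)
  have hcard : (Fintype.card ((Fin 4 → Bool) × (Fin 4 → Fin nn)) : ℝ) = 16 * ((𝔟.b : ℝ) ^ ((j + 1) * s)) ^ 4 := by
    simp only [Fintype.card_prod, Fintype.card_pi, Fintype.card_bool, Finset.prod_const, Finset.card_univ, Fintype.card_fin, hnn]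
    push_cast
    ring
  have hcardpos : 0 < Fintype.card ((Fin 4 → Bool) × (Fin 4 → Fin nn)) := by
    simp only [Fintype.card_prod, Fintype.card_pi, Fintype.card_bool, Finset.prod_const, Finset.card_univ, Fintype.card_fin]
    positivity
  set K : ℝ := 256 * (2 * (m : ℝ) + 4) ^ 4 with hKdef
  have hK0 : 0 < K := by rw [hKdef]; positivity
  let χ : Polymer → GaugeConfig 4 (2 * L + 1) (Matrix.specialUnitaryGroup (Fin N) ℂ) → ℝ := fun γ U =>
    (largeFieldEvent (N := N) 𝔟 e ⟨k + j * s, fun c => γ.y c / (𝔟.b : ℤ) ^ (j * s), γ.μ, γ.ν, γ.hμν⟩ \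
      largeFieldEvent (N := N) 𝔟 (ρ * e)
        ⟨k + (j + 1) * s, fun c => γ.y c / (𝔟.b : ℤ) ^ ((j + 1) * s), γ.μ, γ.ν, γ.hμν⟩).indicator (fun _ => (1 : ℝ))
      (torusLift (2 * L + 1) U)
  have hχ01 : ∀ γ ∈ S, ∀ U, 0 ≤ χ γ U ∧ χ γ U ≤ 1 := fun γ _ U =>
    ⟨Set.indicator_nonneg (fun _ _ => zero_le_one) _, Set.indicator_apply_le' (fun _ => le_rfl) (fun _ => zero_le_one)⟩
  have hχm : ∀ γ ∈ S, Measurable (χ γ) := fun γ _ =>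
    (measurable_const.indicator (measurableSet_guarded (N := N) 𝔟 e (ρ * e) _ _)).comp (measurable_torusLift _)
  -- the class law
  have hlaw : ∀ c₀ : (Fin 4 → Bool) × (Fin 4 → Fin nn), ∀ t' : Polymer → ℝ, (∀ γ ∈ S, 0 ≤ t' γ) →
      ∫ U, Real.exp (∑ γ ∈ S.filter (fun γ => cls γ = c₀), t' γ * χ γ U)
        ∂(wilsonMeasure (d := 4) (L := 2 * L + 1) r.ρ β) ≤
        Real.exp (1 / K * ∑ γ ∈ S.filter (fun γ => cls γ = c₀), (Real.exp (K * t' γ) - 1) * w) := by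
    intro c₀ t' ht'
    set F := S.filter (fun γ => cls γ = c₀) with hFdef
    have hFS : F ⊆ S := Finset.filter_subset _ _
    have hcls : ∀ γ ∈ F, cls γ = c₀ := fun γ hγ => (Finset.mem_filter.1 hγ).2
    have hres : ∀ γ ∈ F, ∀ γ' ∈ F, ∀ c, γ.y c % (𝔟.b : ℤ) ^ ((j + 1) * s) = γ'.y c % (𝔟.b : ℤ) ^ ((j + 1) * s) := by
      intro γ hγ γ' hγ' c
      have h1 : (cls γ).2 c = (cls γ').2 c := by rw [hcls γ hγ, hcls γ' hγ']
      have h2 : (γ.y c % (nn : ℤ)).toNat = (γ'.y c % (nn : ℤ)).toNat := by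
        simpa [cls] using congrArg Fin.val h1
      have h3 : ((γ.y c % (nn : ℤ)).toNat : ℤ) = ((γ'.y c % (nn : ℤ)).toNat : ℤ) := by exact_mod_cast h2
      rw [Int.toNat_of_nonneg (Int.emod_nonneg _ hnnZ.ne'), Int.toNat_of_nonneg (Int.emod_nonneg _ hnnZ.ne')] at h3
      rw [← hnnZ']
      exact h3
    have hσ : ∀ γ ∈ F, ∀ c, decide (0 ≤ (𝔟.b : ℤ) ^ k * γ.y c) = c₀.1 c := by
      intro γ hγ c
      have h1 : (cls γ).1 c = c₀.1 c := by rw [hcls γ hγ]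
      simpa [cls] using h1
    have hbnd : ∀ γ ∈ F, ∀ c, |(𝔟.b : ℤ) ^ k * γ.y c| ≤ (L : ℤ) + 2 * R + 2 := by
      intro γ hγ c
      have h := abs_anchor_le_of_mem_familyShell 𝔟 kmax R L x hred (hS (hFS hγ)) c
      rw [hSk γ (hFS hγ)] at h
      exact h
    have h := torusE_exp_sum_guarded_le_of_kernelBound r β 𝔟 m hm s ρ k j L hfit e w hw0 hGUCR F (fun γ hγ => hSk γ (hFS hγ)) hres hbnd
      hroom c₀.1 hσ t' (fun γ hγ => ht' γ (hFS hγ))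
    refine (le_of_eq ?_).trans (h.trans (le_of_eq ?_))
    · unfold torusE; rfl
    · simp only [hKdef, one_div]
  have key := integral_exp_sum_le_of_partition (wilsonMeasure (d := 4) (L := 2 * L + 1) r.ρ β) hcardpos S χ hχm hχ01 cls hK0
    (fun _ => w) hlaw t ht
  rw [hcard] at key
  unfold torusE
  simpa only [hKdef] using key

end Law

/-! ## §2 The slice moments of the telescoped functional -/

section Slices

variable {N : ℕ} [NeZero N]

omit [NeZero N] in
/-- **The trivial moment of a telescoped slice**: `Σ_{γ ∈ slice_k} a_γ Σ_{j<J} 1_{G_j(γ)} ≤ J·1536·#T` pointwise (per-cube per-level mass), so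
`∫exp(c·slice∘lift) ≤ exp(c·J·1536·#T)` for `c ≥ 0` — for ANY events `G_j`. [folklore] -/
theorem guarded_slice_exp_moment_trivial (β : ℝ) (𝔟 : BlockSize) (kmax R L k J : ℕ) {n : ℕ} (x : Fin n → (Fin 4 → ℤ))
    (T : Finset (Fin n)) (G : Polymer → ℕ → Set (LGConfig 4 (Matrix.specialUnitaryGroup (Fin N) ℂ)))
    (hGm : ∀ γ j, MeasurableSet (G γ j)) {c : ℝ} (hc : 0 ≤ c) :
    ∫ U, Real.exp (c * ∑ γ ∈ (familyShell 𝔟 kmax R x).filter (fun γ => γ.k = k),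
        (∑ i ∈ T, familyCoeff 𝔟 kmax R x i γ) * ∑ j ∈ Finset.range J, (G γ j).indicator (fun _ => (1 : ℝ)) (torusLift (2 * L + 1) U))
      ∂(wilsonMeasure (d := 4) (L := 2 * L + 1) (fundamentalLatticeRep N).ρ β) ≤ Real.exp (c * (J * (1536 * T.card))) := by
  classical
  haveI := isProbabilityMeasure_wilsonMeasure (d := 4) (L := 2 * L + 1) (fundamentalLatticeRep N).ρ
    (fundamentalLatticeRep N).continuous β
  set S := (familyShell 𝔟 kmax R x).filter (fun γ => γ.k = k) with hSdef
  have hSk : ∀ γ ∈ S, γ.k = k := fun γ hγ => (Finset.mem_filter.1 hγ).2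
  have ha0 : ∀ γ, 0 ≤ ∑ i ∈ T, familyCoeff 𝔟 kmax R x i γ := fun γ => Finset.sum_nonneg fun i _ => familyCoeff_nonneg 𝔟 kmax R x i γ
  have hχle : ∀ γ (U : LGConfig 4 (Matrix.specialUnitaryGroup (Fin N) ℂ)),
      ∑ j ∈ Finset.range J, (G γ j).indicator (fun _ => (1 : ℝ)) U ≤ J := fun γ U => by
    calc ∑ j ∈ Finset.range J, (G γ j).indicator (fun _ => (1 : ℝ)) U ≤ ∑ _j ∈ Finset.range J, (1 : ℝ) :=
          Finset.sum_le_sum fun j _ => Set.indicator_apply_le' (fun _ => le_rfl) (fun _ => zero_le_one)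
      _ = J := by simp
  have hχ0 : ∀ γ (U : LGConfig 4 (Matrix.specialUnitaryGroup (Fin N) ℂ)),
      0 ≤ ∑ j ∈ Finset.range J, (G γ j).indicator (fun _ => (1 : ℝ)) U := fun γ U =>
    Finset.sum_nonneg fun j _ => Set.indicator_nonneg (fun _ _ => zero_le_one) _
  have hmass : ∑ γ ∈ S, ∑ i ∈ T, familyCoeff 𝔟 kmax R x i γ ≤ 1536 * T.card := by
    calc ∑ γ ∈ S, ∑ i ∈ T, familyCoeff 𝔟 kmax R x i γ = ∑ i ∈ T, ∑ γ ∈ S, familyCoeff 𝔟 kmax R x i γ := Finset.sum_comm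
      _ ≤ ∑ _i ∈ T, (1536 : ℝ) := Finset.sum_le_sum fun i _ => sum_familyCoeff_slice_le 𝔟 kmax R x i k S hSk
      _ = 1536 * T.card := by rw [Finset.sum_const, nsmul_eq_mul, mul_comm]
  have hJle : ∀ U : LGConfig 4 (Matrix.specialUnitaryGroup (Fin N) ℂ),
      ∑ γ ∈ S, (∑ i ∈ T, familyCoeff 𝔟 kmax R x i γ) * ∑ j ∈ Finset.range J, (G γ j).indicator (fun _ => (1 : ℝ)) U ≤
        J * (1536 * T.card) := by
    intro U
    calc ∑ γ ∈ S, (∑ i ∈ T, familyCoeff 𝔟 kmax R x i γ) * ∑ j ∈ Finset.range J, (G γ j).indicator (fun _ => (1 : ℝ)) U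
        ≤ ∑ γ ∈ S, (∑ i ∈ T, familyCoeff 𝔟 kmax R x i γ) * J :=
          Finset.sum_le_sum fun γ _ => mul_le_mul_of_nonneg_left (hχle γ U) (ha0 γ)
      _ = J * ∑ γ ∈ S, ∑ i ∈ T, familyCoeff 𝔟 kmax R x i γ := by rw [← Finset.sum_mul, mul_comm]
      _ ≤ J * (1536 * T.card) := mul_le_mul_of_nonneg_left hmass (Nat.cast_nonneg _)
  have hmeas : Measurable fun U : GaugeConfig 4 (2 * L + 1) (Matrix.specialUnitaryGroup (Fin N) ℂ) => Real.exp (c * ∑ γ ∈ S,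
      (∑ i ∈ T, familyCoeff 𝔟 kmax R x i γ) * ∑ j ∈ Finset.range J, (G γ j).indicator (fun _ => (1 : ℝ)) (torusLift (2 * L + 1) U)) :=
    ((Finset.measurable_sum _ fun γ _ => (Finset.measurable_sum _ fun j _ =>
      (measurable_const.indicator (hGm γ j)).comp (measurable_torusLift _)).const_mul _).const_mul _).exp
  have hpt : ∀ U : GaugeConfig 4 (2 * L + 1) (Matrix.specialUnitaryGroup (Fin N) ℂ), Real.exp (c * ∑ γ ∈ S,
      (∑ i ∈ T, familyCoeff 𝔟 kmax R x i γ) * ∑ j ∈ Finset.range J, (G γ j).indicator (fun _ => (1 : ℝ)) (torusLift (2 * L + 1) U)) ≤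
      Real.exp (c * (J * (1536 * T.card))) := fun U => Real.exp_le_exp.2 (mul_le_mul_of_nonneg_left (hJle _) hc)
  calc _ ≤ ∫ _U, Real.exp (c * (J * (1536 * T.card))) ∂(wilsonMeasure (d := 4) (L := 2 * L + 1) (fundamentalLatticeRep N).ρ β) :=
        integral_mono (integrable_of_abs_le hmeas (C := Real.exp (c * (J * (1536 * T.card)))) fun U => by
          rw [Real.abs_exp]; exact hpt U) (integrable_const _) hpt
    _ = Real.exp (c * (J * (1536 * T.card))) := by rw [integral_const, smul_eq_mul, probReal_univ, one_mul]

/-- **THE DEEP MOMENT OF A TELESCOPED SLICE — LINEAR IN THE (GUCR) WEIGHTS.**  Fundamental `SU(N)`, odd torus `2L+1`, any `β`; a REDUCED cube family;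
block size `𝔟`, collar `m ≥ 3`, guard depth `s`, ratio `ρ`, `J ≥ 1` chain steps, level `k ≥ 1`, thresholds `ρ^j·e₀` along the chain; every parent
level `k + (j+1)s` (`j < J`) fits (`(2m+1)b^{k+(j+1)s} + 3 ≤ 2L+1`, `L + 2R + 2 + 2b^{k+(j+1)s} ≤ 2L+1`); weights `w ≥ 0` with (GUCR) at the child
levels `k + js` for the thresholds `ρ^j e₀`; a rate `c ≥ 0` with the linearisation condition `16·b^{4(j+1)s}·256(2m+4)⁴·(J·c·a_γ) ≤ 1` on the slice.
THEN `∫exp(c·Σ_{γ∈slice_k} a_γ Σ_{j<J} 1_{G_j(γ)}∘lift) ≤ exp(c·(e−1)·1536·(Σ_{j<J} w_{k+js})·#T)` — Hölder over `j` (exponents `J`), each step by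
`torusE_exp_sum_guarded_le_of_reduced` and `linearised_budget`. [folklore] -/
theorem guarded_slice_exp_moment_deep (β : ℝ) (𝔟 : BlockSize) (m : ℕ) (hm : 3 ≤ m) (s J : ℕ) (hJ : 1 ≤ J) (ρ e₀ : ℝ)
    (kmax R L k : ℕ) {n : ℕ} (x : Fin n → (Fin 4 → ℤ)) (hred : ∀ i c, |x i c| ≤ (L : ℤ)) (T : Finset (Fin n))
    (hfit : ∀ j, j < J → (2 * m + 1) * 𝔟.b ^ (k + (j + 1) * s) + 3 ≤ 2 * L + 1)
    (hroom : ∀ j, j < J → (L : ℤ) + 2 * R + 2 + 2 * (𝔟.b : ℤ) ^ (k + (j + 1) * s) ≤ 2 * L + 1)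
    (w : ℕ → ℝ) (hw0 : ∀ k, 0 ≤ w k)
    (hGUCR : ∀ j, j < J → ∀ (z : Fin 4 → ℤ) (μ ν : Fin 4) (h : μ < ν) (η : LGConfig 4 (Matrix.specialUnitaryGroup (Fin N) ℂ)),
      kerE (Matrix.specialUnitaryGroup (Fin N) ℂ) (fundamentalLatticeRep N) β
        (fun c => (𝔟.b : ℤ) ^ (k + (j + 1) * s) * (z c / (𝔟.b : ℤ) ^ s - m)) ((2 * m + 1) * 𝔟.b ^ (k + (j + 1) * s)) η
        ((largeFieldEvent (N := N) 𝔟 (ρ ^ j * e₀) ⟨k + j * s, z, μ, ν, h⟩ \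
          largeFieldEvent (N := N) 𝔟 (ρ * (ρ ^ j * e₀)) ⟨k + (j + 1) * s, fun c => z c / (𝔟.b : ℤ) ^ s, μ, ν, h⟩).indicator
            fun _ => (1 : ℝ)) ≤ w (k + j * s))
    {c : ℝ} (hc : 0 ≤ c)
    (hsmall : ∀ γ ∈ (familyShell 𝔟 kmax R x).filter (fun γ => γ.k = k), ∀ j, j < J →
      16 * ((𝔟.b : ℝ) ^ ((j + 1) * s)) ^ 4 * (256 * (2 * (m : ℝ) + 4) ^ 4) * ((J : ℝ) * (c * ∑ i ∈ T, familyCoeff 𝔟 kmax R x i γ)) ≤ 1) :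
    ∫ U, Real.exp (c * ∑ γ ∈ (familyShell 𝔟 kmax R x).filter (fun γ => γ.k = k),
        (∑ i ∈ T, familyCoeff 𝔟 kmax R x i γ) * ∑ j ∈ Finset.range J,
          (largeFieldEvent (N := N) 𝔟 (ρ ^ j * e₀) ⟨k + j * s, fun c => γ.y c / (𝔟.b : ℤ) ^ (j * s), γ.μ, γ.ν, γ.hμν⟩ \
            largeFieldEvent (N := N) 𝔟 (ρ ^ (j + 1) * e₀)
              ⟨k + (j + 1) * s, fun c => γ.y c / (𝔟.b : ℤ) ^ ((j + 1) * s), γ.μ, γ.ν, γ.hμν⟩).indicator (fun _ => (1 : ℝ))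
            (torusLift (2 * L + 1) U))
      ∂(wilsonMeasure (d := 4) (L := 2 * L + 1) (fundamentalLatticeRep N).ρ β) ≤
      Real.exp (c * ((Real.exp 1 - 1) * 1536 * (∑ j ∈ Finset.range J, w (k + j * s)) * T.card)) := by
  classical
  haveI := isProbabilityMeasure_wilsonMeasure (d := 4) (L := 2 * L + 1) (fundamentalLatticeRep N).ρ
    (fundamentalLatticeRep N).continuous β
  set μT := wilsonMeasure (d := 4) (L := 2 * L + 1) (fundamentalLatticeRep N).ρ β with hμT
  set S := (familyShell 𝔟 kmax R x).filter (fun γ => γ.k = k) with hSdef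
  have hSk : ∀ γ ∈ S, γ.k = k := fun γ hγ => (Finset.mem_filter.1 hγ).2
  have hSsub : S ⊆ familyShell 𝔟 kmax R x := Finset.filter_subset _ _
  set a : Polymer → ℝ := fun γ => ∑ i ∈ T, familyCoeff 𝔟 kmax R x i γ with hadef
  have ha0 : ∀ γ, 0 ≤ a γ := fun γ => Finset.sum_nonneg fun i _ => familyCoeff_nonneg 𝔟 kmax R x i γ
  have hmass : ∑ γ ∈ S, a γ ≤ 1536 * T.card := by
    calc ∑ γ ∈ S, a γ = ∑ i ∈ T, ∑ γ ∈ S, familyCoeff 𝔟 kmax R x i γ := Finset.sum_comm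
      _ ≤ ∑ _i ∈ T, (1536 : ℝ) := Finset.sum_le_sum fun i _ => sum_familyCoeff_slice_le 𝔟 kmax R x i k S hSk
      _ = 1536 * T.card := by rw [Finset.sum_const, nsmul_eq_mul, mul_comm]
  -- the events and the per-step functionals
  let G : ℕ → Polymer → Set (LGConfig 4 (Matrix.specialUnitaryGroup (Fin N) ℂ)) := fun j γ =>
    largeFieldEvent (N := N) 𝔟 (ρ ^ j * e₀) ⟨k + j * s, fun c => γ.y c / (𝔟.b : ℤ) ^ (j * s), γ.μ, γ.ν, γ.hμν⟩ \
      largeFieldEvent (N := N) 𝔟 (ρ ^ (j + 1) * e₀) ⟨k + (j + 1) * s, fun c => γ.y c / (𝔟.b : ℤ) ^ ((j + 1) * s), γ.μ, γ.ν, γ.hμν⟩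
  have hχ01 : ∀ j γ (U : LGConfig 4 (Matrix.specialUnitaryGroup (Fin N) ℂ)),
      0 ≤ (G j γ).indicator (fun _ => (1 : ℝ)) U ∧ (G j γ).indicator (fun _ => (1 : ℝ)) U ≤ 1 := fun j γ U =>
    ⟨Set.indicator_nonneg (fun _ _ => zero_le_one) _, Set.indicator_apply_le' (fun _ => le_rfl) (fun _ => zero_le_one)⟩
  have hGm : ∀ j γ, MeasurableSet (G j γ) := fun j γ => measurableSet_guarded (N := N) 𝔟 _ _ _ _
  let F : ℕ → GaugeConfig 4 (2 * L + 1) (Matrix.specialUnitaryGroup (Fin N) ℂ) → ℝ := fun j U =>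
    c * ∑ γ ∈ S, a γ * (G j γ).indicator (fun _ => (1 : ℝ)) (torusLift (2 * L + 1) U)
  have hFm : ∀ j ∈ Finset.range J, Measurable (F j) := fun j _ =>
    (Finset.measurable_sum _ fun γ _ => ((measurable_const.indicator (hGm j γ)).comp (measurable_torusLift _)).const_mul _).const_mul _
  have hF0 : ∀ j U, 0 ≤ F j U := fun j U => mul_nonneg hc (Finset.sum_nonneg fun γ _ => mul_nonneg (ha0 γ) (hχ01 j γ _).1)
  have hFb : ∀ j ∈ Finset.range J, ∀ U, |F j U| ≤ c * (1536 * T.card) := by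
    intro j _ U
    rw [abs_of_nonneg (hF0 j U)]
    refine mul_le_mul_of_nonneg_left ?_ hc
    exact (Finset.sum_le_sum fun γ _ => by simpa using mul_le_mul_of_nonneg_left (hχ01 j γ _).2 (ha0 γ)).trans hmass
  -- the integrand in Hölder form
  have hlhs : ∀ U : GaugeConfig 4 (2 * L + 1) (Matrix.specialUnitaryGroup (Fin N) ℂ),
      c * ∑ γ ∈ S, a γ * ∑ j ∈ Finset.range J, (G j γ).indicator (fun _ => (1 : ℝ)) (torusLift (2 * L + 1) U) =
        ∑ j ∈ Finset.range J, F j U := by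
    intro U
    simp only [F, ← Finset.mul_sum]
    congr 1
    rw [Finset.sum_comm]
    exact Finset.sum_congr rfl fun γ _ => Finset.mul_sum _ _ _
  have hJpos : (0 : ℝ) < J := by exact_mod_cast hJ
  have he1 : 0 ≤ Real.exp 1 - 1 := by linarith [Real.add_one_le_exp (1 : ℝ)]
  -- per step: the law of §1 with coefficients `J·c·a`, linearised
  have hmom : ∀ j ∈ Finset.range J, ∫ U, Real.exp ((J : ℝ) * F j U) ∂μT ≤
      Real.exp ((J : ℝ) * (c * ((Real.exp 1 - 1) * 1536 * w (k + j * s) * T.card))) := by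
    intro j hj
    have hjJ : j < J := Finset.mem_range.1 hj
    set Kj : ℝ := 16 * ((𝔟.b : ℝ) ^ ((j + 1) * s)) ^ 4 * (256 * (2 * (m : ℝ) + 4) ^ 4) with hKjdef
    have hKj0 : 0 < Kj := by
      rw [hKjdef]
      have : (0 : ℝ) < (𝔟.b : ℝ) := by exact_mod_cast 𝔟.pos
      positivity
    have hG' : ∀ (z : Fin 4 → ℤ) (μ ν : Fin 4) (h : μ < ν) (η : LGConfig 4 (Matrix.specialUnitaryGroup (Fin N) ℂ)),
        kerE (Matrix.specialUnitaryGroup (Fin N) ℂ) (fundamentalLatticeRep N) β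
          (fun c => (𝔟.b : ℤ) ^ (k + (j + 1) * s) * (z c / (𝔟.b : ℤ) ^ s - m)) ((2 * m + 1) * 𝔟.b ^ (k + (j + 1) * s)) η
          ((largeFieldEvent (N := N) 𝔟 (ρ ^ j * e₀) ⟨k + j * s, z, μ, ν, h⟩ \
            largeFieldEvent (N := N) 𝔟 (ρ * (ρ ^ j * e₀)) ⟨k + (j + 1) * s, fun c => z c / (𝔟.b : ℤ) ^ s, μ, ν, h⟩).indicator
              fun _ => (1 : ℝ)) ≤ w (k + j * s) := hGUCR j hjJ
    have hlaw := torusE_exp_sum_guarded_le_of_reduced (fundamentalLatticeRep N) β 𝔟 m hm s ρ k j kmax R L x hred (hfit j hjJ)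
      (hroom j hjJ) (ρ ^ j * e₀) (w (k + j * s)) (hw0 _) hG' S hSsub hSk (fun γ => (J : ℝ) * (c * a γ))
      (fun γ _ => mul_nonneg hJpos.le (mul_nonneg hc (ha0 γ)))
    have hlin := linearised_budget S (fun γ => (J : ℝ) * (c * a γ)) (K' := Kj) hKj0 (hw0 (k + j * s))
      (fun γ _ => mul_nonneg hJpos.le (mul_nonneg hc (ha0 γ))) (fun γ hγ => by simpa only [hKjdef, hadef] using hsmall γ hγ j hjJ)
    have hρ : ρ * (ρ ^ j * e₀) = ρ ^ (j + 1) * e₀ := by ring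
    have hlhs' : ∫ U, Real.exp ((J : ℝ) * F j U) ∂μT =
        torusE (Matrix.specialUnitaryGroup (Fin N) ℂ) (fundamentalLatticeRep N) β L (fun U => Real.exp (∑ γ ∈ S,
          (J : ℝ) * (c * a γ) * (G j γ).indicator (fun _ => (1 : ℝ)) U)) := by
      unfold torusE
      refine integral_congr_ae (ae_of_all _ fun U => congrArg Real.exp ?_)
      simp only [F, Finset.mul_sum]
      exact Finset.sum_congr rfl fun γ _ => by ring
    rw [hlhs']
    simp only [G, ← hρ]
    refine hlaw.trans (Real.exp_le_exp.2 ?_)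
    rw [← hKjdef]
    calc 1 / Kj * ∑ γ ∈ S, (Real.exp (Kj * ((J : ℝ) * (c * a γ))) - 1) * w (k + j * s)
        ≤ (Real.exp 1 - 1) * w (k + j * s) * ∑ γ ∈ S, (J : ℝ) * (c * a γ) := hlin
      _ = (J : ℝ) * (c * ((Real.exp 1 - 1) * w (k + j * s) * ∑ γ ∈ S, a γ)) := by
          rw [← Finset.mul_sum, ← Finset.mul_sum]; ring
      _ ≤ (J : ℝ) * (c * ((Real.exp 1 - 1) * w (k + j * s) * (1536 * T.card))) := by
          refine mul_le_mul_of_nonneg_left (mul_le_mul_of_nonneg_left (mul_le_mul_of_nonneg_left hmass ?_) hc) hJpos.le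
          exact mul_nonneg he1 (hw0 _)
      _ = (J : ℝ) * (c * ((Real.exp 1 - 1) * 1536 * w (k + j * s) * T.card)) := by ring
  -- Hölder over the steps, all exponents `J`
  have key := PolymerRarity.integral_exp_sum_le_exp_sum_of_holder μT (Finset.range J) F hFm (fun _ => c * (1536 * T.card)) hFb
    (fun _ => (J : ℝ)) (fun j => c * ((Real.exp 1 - 1) * 1536 * w (k + j * s) * T.card)) (fun _ _ => hJpos)
    (by rw [Finset.sum_const, Finset.card_range, nsmul_eq_mul, mul_one_div_cancel hJpos.ne']) hmom
  simp only [← hlhs] at key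
  refine key.trans (le_of_eq (congrArg Real.exp ?_))
  simp only [Finset.mul_sum, Finset.sum_mul]

end Slices

end Summit.QuantumFields.YangMills.Cruxes.UVSeamRec.DLRPeeling

end
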